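import Mathlib
import Literature.AlgebraicGeometry.Resolution.RootAdjunctionRegular

/-!
# LEMMA R — the root-layer regularity criterion (`RootLayerCriterion p`)

Crux workfile for `stmt-ResolutionOfSingularities-0549` (`Theses.Descent.DescentPerfectToAll`),
lens-3 g8, answering TRIAGE-56 ask (2): the criterion used by the root-layer escapes
(P3 `RootLayerEscape`, P3′ `RelRootLayerEscape`) of `Lines/separated_layer_sketch.lean` §8,
stated there verbatim as `SeparatedLayer.RootLayerCriterion` (l.464) and proved here.

**LEMMA R.** Let `S` be a regular local ring of prime characteristic `p`, `w ∈ S`, and suppose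
`w - c ^ p ∉ 𝔪_S ^ 2` for every `c ∈ S`.  Then `S[X]/(X^p - w)` is a regular local ring.

Proof (two cases, both reduced to facts already in the tree / Mathlib):
* field case (`w - c^p ∉ 𝔪_S` for all `c`, i.e. `w̄ ∉ κ^p`): `X^p - w̄` is irreducible over the
  residue field (Kummer, `X_pow_sub_C_irreducible_of_prime`), so the fibre `B/𝔪_S B` is a field,
  `B` is local with `𝔪_B = 𝔪_S B`, `dim B = dim S` (integrality) and `B` is regular because
  `𝔪_B` needs at most `dim S` generators;
* parameter case (`w - c₀^p ∈ 𝔪_S ∖ 𝔪_S²` for some `c₀`): translate `X ↦ X + c₀` (Frobenius is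
  additive), so `B ≅ S[X]/(X^p - w')` with `w' := w - c₀^p` a regular parameter; extend `w'` to a
  regular system of parameters (`exists_span_insert_eq_maximalIdeal`) and apply the tree theorem
  `AdjoinRoot.isRegularLocalRing_X_pow_sub_C`.

bears_on: LADDER-RESOLUTION:B · [OURS · CANDIDATE] counted 0; nothing here proves resolution in
char p (LEMMA R is commutative algebra about one root adjunction).
-/

open Polynomial IsLocalRing

namespace Summit.ResolutionOfSingularities.ResolutionOfSingularities.Cruxes.DescentPerfectToAll.RootLayer

/-- LEMMA R, verbatim restatement of `SeparatedLayer.RootLayerCriterion` (sketch l.464). -/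
def RootLayerCriterion (p : ℕ) [Fact p.Prime] : Prop :=
  ∀ (S : Type) [CommRing S] [IsRegularLocalRing S] [CharP S p] (w : S),
    (∀ c : S, w - c ^ p ∉ (IsLocalRing.maximalIdeal S) ^ 2) →
      IsRegularLocalRing (AdjoinRoot (X ^ p - C w : S[X]))

/-- The field case of LEMMA R: the residue of `w` is not a `p`-th power. -/
def RootLayerFieldCase (p : ℕ) [Fact p.Prime] : Prop :=
  ∀ (S : Type) [CommRing S] [IsRegularLocalRing S] [CharP S p] (w : S),
    (∀ c : S, w - c ^ p ∉ IsLocalRing.maximalIdeal S) →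
      IsRegularLocalRing (AdjoinRoot (X ^ p - C w : S[X]))

/-- Parameter case: adjoining a `p`-th root (any `p > 0`) of a regular parameter `w ∈ 𝔪 ∖ 𝔪²`
of a regular local ring gives a regular local ring (packaging of the tree theorem
`AdjoinRoot.isRegularLocalRing_X_pow_sub_C` with `exists_span_insert_eq_maximalIdeal`). -/
theorem parameterCase {p : ℕ} (hp : 0 < p) (S : Type) [CommRing S] [IsRegularLocalRing S]
    (w : S) (hw : w ∈ maximalIdeal S) (hw2 : w ∉ (maximalIdeal S) ^ 2) :
    IsRegularLocalRing (AdjoinRoot (X ^ p - C w : S[X])) := by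
  classical
  obtain ⟨s, hsfin, hcard, hspan⟩ :=
    Literature.AlgebraicGeometry.Resolution.exists_span_insert_eq_maximalIdeal hw hw2
  obtain ⟨m, f, hf⟩ := hsfin.fin_embedding
  have hsm : s.ncard = m := by
    rw [← hf, Set.ncard_range_of_injective f.injective, Nat.card_eq_fintype_card, Fintype.card_fin]
  have hle : (maximalIdeal S).spanFinrank ≤ m + 1 := by
    have h1 : (Ideal.span (insert w s)).spanFinrank ≤ (insert w s).ncard :=
      Submodule.spanFinrank_span_le_ncard_of_finite (hsfin.insert w)
    have h2 : (insert w s).ncard ≤ s.ncard + 1 := Set.ncard_insert_le w s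
    rw [hspan] at h1
    omega
  have heq : (maximalIdeal S).spanFinrank = m + 1 := by omega
  have hdim : ringKrullDim S = m + 1 := by
    rw [← IsRegularLocalRing.spanFinrank_maximalIdeal (R := S), heq]
    push_cast
    rfl
  obtain ⟨_, hreg, -⟩ :=
    Literature.AlgebraicGeometry.Resolution.AdjoinRoot.isRegularLocalRing_X_pow_sub_C
      (A := S) f w (by rw [hf]; exact hspan) hdim hp
  exact hreg

/-- The translation `X ↦ X - c` identifies `S[X]/(X^p - (w - c^p))` with `S[X]/(X^p - w)` in
characteristic `p` (Frobenius is additive). -/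
theorem translateEquiv (p : ℕ) [Fact p.Prime] (S : Type) [CommRing S] [IsDomain S] [CharP S p]
    (w c : S) :
    Nonempty (AdjoinRoot (X ^ p - C (w - c ^ p) : S[X]) ≃+* AdjoinRoot (X ^ p - C w : S[X])) := by
  have hp : 0 < p := (Fact.out : p.Prime).pos
  set g : S[X] := X ^ p - C w with hg
  set g' : S[X] := X ^ p - C (w - c ^ p) with hg'
  have hinj : Function.Injective (algebraMap S (AdjoinRoot g)) :=
    AdjoinRoot.of.injective_of_degree_ne_zero
      (by rw [hg, degree_X_pow_sub_C hp w]; exact_mod_cast hp.ne')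
  have hinj' : Function.Injective (algebraMap S (AdjoinRoot g')) :=
    AdjoinRoot.of.injective_of_degree_ne_zero
      (by rw [hg', degree_X_pow_sub_C hp (w - c ^ p)]; exact_mod_cast hp.ne')
  haveI : CharP (AdjoinRoot g) p := charP_of_injective_algebraMap hinj p
  haveI : CharP (AdjoinRoot g') p := charP_of_injective_algebraMap hinj' p
  have hz : AdjoinRoot.root g ^ p = AdjoinRoot.of g w := by
    have h := AdjoinRoot.eval₂_root g
    rw [hg, eval₂_sub, eval₂_X_pow, eval₂_C, sub_eq_zero] at h
    exact h
  have hz' : AdjoinRoot.root g' ^ p = AdjoinRoot.of g' (w - c ^ p) := by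
    have h := AdjoinRoot.eval₂_root g'
    rw [hg', eval₂_sub, eval₂_X_pow, eval₂_C, sub_eq_zero] at h
    exact h
  -- φ : root' ↦ root - c
  have hφ : g'.eval₂ (↑(Algebra.ofId S (AdjoinRoot g)) : S →+* AdjoinRoot g)
      (AdjoinRoot.root g - AdjoinRoot.of g c) = 0 := by
    rw [hg', eval₂_sub, eval₂_X_pow, eval₂_C, sub_pow_char, hz]
    simp only [AlgHom.coe_toRingHom, Algebra.ofId_apply, AdjoinRoot.algebraMap_eq, map_sub,
      map_pow]
    ring
  have hψ : g.eval₂ (↑(Algebra.ofId S (AdjoinRoot g')) : S →+* AdjoinRoot g')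
      (AdjoinRoot.root g' + AdjoinRoot.of g' c) = 0 := by
    rw [hg, eval₂_sub, eval₂_X_pow, eval₂_C, add_pow_char, hz']
    simp only [AlgHom.coe_toRingHom, Algebra.ofId_apply, AdjoinRoot.algebraMap_eq, map_sub,
      map_pow]
    ring
  let φ : AdjoinRoot g' →ₐ[S] AdjoinRoot g :=
    AdjoinRoot.liftAlgHom g' (Algebra.ofId S (AdjoinRoot g)) _ hφ
  let ψ : AdjoinRoot g →ₐ[S] AdjoinRoot g' :=
    AdjoinRoot.liftAlgHom g (Algebra.ofId S (AdjoinRoot g')) _ hψ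
  have h1 : φ.comp ψ = AlgHom.id S _ := by
    apply AdjoinRoot.algHom_ext
    simp [φ, ψ, AdjoinRoot.liftAlgHom_root, map_add, AdjoinRoot.liftAlgHom_of]
  have h2 : ψ.comp φ = AlgHom.id S _ := by
    apply AdjoinRoot.algHom_ext
    simp [φ, ψ, AdjoinRoot.liftAlgHom_root, map_sub, AdjoinRoot.liftAlgHom_of]
  exact ⟨(AlgEquiv.ofAlgHom φ ψ h1 h2).toRingEquiv⟩

/-- Kernel composition: the field case implies LEMMA R (the parameter case and the translation
being proved above). -/
theorem RootLayerCriterion_of (p : ℕ) [Fact p.Prime] (hF : RootLayerFieldCase p) :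
    RootLayerCriterion p := by
  intro S _ _ _ w hw
  by_cases h : ∀ c : S, w - c ^ p ∉ maximalIdeal S
  · exact hF S w h
  · push Not at h
    obtain ⟨c, hc⟩ := h
    haveI : IsDomain S := Literature.AlgebraicGeometry.Resolution.isDomain_of_isRegularLocalRing S
    haveI := parameterCase (Fact.out : p.Prime).pos S (w - c ^ p) hc (hw c)
    obtain ⟨e⟩ := translateEquiv p S w c
    exact IsRegularLocalRing.of_ringEquiv e

/-- The field case of LEMMA R. -/
theorem rootLayerFieldCase (p : ℕ) [Fact p.Prime] : RootLayerFieldCase p := by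
  intro S _ _ _ w hw
  classical
  have hp : 0 < p := (Fact.out : p.Prime).pos
  set g : S[X] := X ^ p - C w with hg
  have hmon : g.Monic := Literature.AlgebraicGeometry.Resolution.monic_X_pow_sub_C_of_pos w hp
  haveI : Module.Finite S (AdjoinRoot g) := hmon.finite_adjoinRoot
  haveI : Algebra.IsIntegral S (AdjoinRoot g) := inferInstance
  haveI : IsDomain S := Literature.AlgebraicGeometry.Resolution.isDomain_of_isRegularLocalRing S
  have hinj : Function.Injective (algebraMap S (AdjoinRoot g)) :=
    AdjoinRoot.of.injective_of_degree_ne_zero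
      (by rw [hg, degree_X_pow_sub_C hp w]; exact_mod_cast hp.ne')
  -- the reduction of `g` mod `𝔪_S` is an irreducible Kummer polynomial (typed over
  -- `ResidueField S`; the raw quotient `S ⧸ 𝔪` makes instance unification time out)
  have hirr : Irreducible (X ^ p - C (residue S w) : (ResidueField S)[X]) := by
    refine X_pow_sub_C_irreducible_of_prime (Fact.out : p.Prime) ?_
    intro b hb
    obtain ⟨c, rfl⟩ := IsLocalRing.residue_surjective b
    apply hw c
    rw [← IsLocalRing.residue_eq_zero_iff, map_sub, map_pow, hb, sub_self]
  have hmapg : g.map (residue S) = X ^ p - C (residue S w) := by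
    rw [hg, Polynomial.map_sub, Polynomial.map_pow, Polynomial.map_X, Polynomial.map_C]
  have hmaxbar : (Ideal.span {g.map (residue S)} : Ideal (ResidueField S)[X]).IsMaximal := by
    rw [hmapg]
    exact PrincipalIdealRing.isMaximal_of_irreducible hirr
  -- hence the fibre ideal `𝔪_S B` is maximal
  set I : Ideal (AdjoinRoot g) := (maximalIdeal S).map (AdjoinRoot.of g) with hI
  have e : (AdjoinRoot g ⧸ I) ≃+* ((ResidueField S)[X] ⧸ Ideal.span {g.map (residue S)}) :=
    AdjoinRoot.quotAdjoinRootEquivQuotPolynomialQuot (maximalIdeal S) g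
  have hImax : I.IsMaximal := by
    apply Ideal.Quotient.maximal_of_isField
    exact MulEquiv.isField
      ((Ideal.Quotient.maximal_ideal_iff_isField_quotient _).mp hmaxbar) e.toMulEquiv
  -- `B` is local with maximal ideal `I`
  have huniq : ∀ n : Ideal (AdjoinRoot g), n.IsMaximal → n = I := by
    intro n hn
    have hc : n.comap (algebraMap S (AdjoinRoot g)) = maximalIdeal S := by
      haveI : (n.comap (algebraMap S (AdjoinRoot g))).IsMaximal :=
        Ideal.isMaximal_comap_of_isIntegral_of_isMaximal n
      exact IsLocalRing.eq_maximalIdeal inferInstance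
    have hle : I ≤ n := by
      rw [hI, Ideal.map_le_iff_le_comap]
      exact hc.ge
    exact (hImax.eq_of_le hn.ne_top hle).symm
  haveI : IsLocalRing (AdjoinRoot g) := IsLocalRing.of_unique_max_ideal ⟨I, hImax, huniq⟩
  have hmax : maximalIdeal (AdjoinRoot g) = I :=
    huniq _ (IsLocalRing.maximalIdeal.isMaximal (AdjoinRoot g))
  -- dimension and regularity
  have hdim : ringKrullDim (AdjoinRoot g) = ringKrullDim S :=
    (Literature.RingTheory.KrullDimension.ringKrullDim_eq_of_isIntegral hinj).symm
  haveI : IsNoetherianRing (AdjoinRoot g) := inferInstance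
  refine IsRegularLocalRing.of_spanFinrank_maximalIdeal_le _ ?_
  rw [hdim, ← IsRegularLocalRing.spanFinrank_maximalIdeal (R := S), hmax, hI]
  exact_mod_cast Ideal.spanFinrank_map_le_of_fg _ (IsNoetherian.noetherian _)

/-- **LEMMA R** (`RootLayerCriterion p`), proved. -/
theorem rootLayerCriterion (p : ℕ) [Fact p.Prime] : RootLayerCriterion p :=
  RootLayerCriterion_of p (rootLayerFieldCase p)

end Summit.ResolutionOfSingularities.ResolutionOfSingularities.Cruxes.DescentPerfectToAll.RootLayer
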